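import Mathlib
import Literature.Probability.LatticeModels.ProdBernoulliIndependence
import Literature.Probability.Percolation.KozmaNitzanPinning
import Literature.Probability.Percolation.ClusterBoundary
import Literature.Probability.Percolation.PercolationProofs
import Summits.CriticalPhenomena.PercolationContinuityZ3.Theorems.PercNearOneGluingNearOneGluingPocketBound
import Summits.CriticalPhenomena.PercolationContinuityZ3.Theorems.PercNearOneGluingNearOneGluingPocketBoundAux
import Summits.CriticalPhenomena.PercolationContinuityZ3.Theorems.PercNearOneGluingNoHeavyLowerTailDepthOneGluingAdm
import HarnessLib

/-!
# Crux `PercNearOneGluing.NoHeavyLowerTail` (stmt-CriticalPhenomena-4575), line `bhk-superadditivity-thinning` —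
# sub-goal `pocketSelectionBound` (the pocket selection bound)

Helper file for the crux (lead prover-line-stmt-CriticalPhenomena-4575-0): tooling for the
residual `stub_manyFingersLargePocket`.  Proves exactly the registered sub-goal signature; lands
with `--supports stmt-CriticalPhenomena-4575`.

## Content: THE POCKET SELECTION BOUND

For `μ = prodBernoulli w` on the pairs of `Fin n`, a relay set `A`, an observer `o ∉ A`, a hub
`b ∈ A` and ANY selection rule `S₀ ↦ sel S₀` that is *admissible* — for every pocket shape
`S₀ ∋ o` disjoint from `A` and every relay point `v ∈ A` joined to `S₀` by a positive-weight pair,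
the connection probability `sel S₀ ↔ b` with all pairs touching `S₀` closed is at most that of
`v ↔ b` — the gluing defect is controlled by the selected points:
`μ(o ↔ A, o ↮ b) ≤ Σ_{S₀ ∋ o, S₀ ∩ A = ∅} μ(pocket = S₀, o ↔ A, sel S₀ ↮ b)`,
where the *relay-free pocket* of `ω` is `{v | ω ∈ openConnIn (↑A)ᶜ o v}`.

Proof.  Partition the bad event by the value `S₀` of the pocket (as in the sibling `pocketBound`).
If `sel S₀ ∈ S₀` the summand dominates trivially (`sel S₀` lies in the pocket, so `sel S₀ ↔ b`
would give `o ↔ b`).  Otherwise contract `S₀` onto `o` with the merge map `Φ` of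
`…PocketBoundAux.lean` (law `prodBernoulli w'`):
`{bad} ∩ {pocket = S₀} ⊆ {span} ∩ {∂S₀ closed} ∩ Φ⁻¹{o ↔ A, o ↮ b}` (`merge_mem_bad`), the three
events are independent, and in the merged world `o` is `w'`-isolated off `A`, so depth-one gluing
through the admissible point `sel S₀` (`depthOneGluing_admissible`, Kozma–Nitzan Thm 4 / Lemma 5)
gives `μ'(o ↔ A, o ↮ b) ≤ μ'(o ↔ A, sel S₀ ↮ b)`.  The admissibility hypothesis transfers because
the merged weights with the star of `o` pinned closed are LITERALLY the original weights with all
pairs touching `S₀` pinned closed (`pinW_star_merge_eq`), and `w' s(o, v) ≠ 0` forces a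
positive-weight pair from `S₀` to `v`.  Finally
`{span} ∩ {∂S₀ closed} ∩ Φ⁻¹{o ↔ A, sel S₀ ↮ b} ⊆ {pocket = S₀} ∩ {o ↔ A} ∩ {sel S₀ ↮ b}`
(`mem_pocket_inter_of_merge`, using `merge_mem_openConn`), and independence again.
-/

namespace Summit.CriticalPhenomena.PercolationContinuityZ3.Theorems

open scoped BigOperators Classical
open MeasureTheory Set
open Literature.Probability.LatticeModels (prodBernoulli prodBernoulli_real_inter_of_determinedBy)
open Literature.Probability.Percolation

section PocketSelection

variable {n : ℕ} {S₀ A : Finset (Fin n)} {o : Fin n}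
  {π : Sym2 (Fin n) → Option (Sym2 (Fin n))} {Φ : Set (Sym2 (Fin n)) → Set (Sym2 (Fin n))}
  {F₀ : Finset (Sym2 (Fin n))} {w w' : Sym2 (Fin n) → unitInterval}

/-- **The merged weights with the star of `o` closed are the original weights with all pairs
touching `S₀` closed.** A pair avoiding `S₀` is its own fibre (merged weight `w e`) and lies
outside both pinned sets; a pair touching `S₀` is pinned to `0` on the right, and on the left it is
either in the star of `o` (pinned to `0`) or has empty fibre (merged weight `0`). -/
private theorem pinW_star_merge_eq {F : Finset (Sym2 (Fin n))}
    (hF : ∀ e, e ∈ F ↔ o ∈ e ∧ ¬ e.IsDiag)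
    (hπ1 : ∀ x y, x ∉ S₀ → y ∉ S₀ → π s(x, y) = some s(x, y))
    (hπ3 : ∀ x y k, π s(x, y) = some k → (x ∉ S₀ ∧ y ∉ S₀ ∧ k = s(x, y)) ∨
      (x ∈ S₀ ∧ y ∈ A ∧ k = s(o, y)) ∨ (y ∈ S₀ ∧ x ∈ A ∧ k = s(o, x)))
    (hw' : ∀ k, (w' k : ℝ) = 1 - ∏ e ∈ Finset.univ.filter (fun e => π e = some k), (1 - (w e : ℝ)))
    (ho : o ∈ S₀) (hoA : o ∉ A) :
    pinW w' (↑F : Set (Sym2 (Fin n))) (∅ : Set (Sym2 (Fin n))) =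
      pinW w (edgesTouching (↑S₀ : Set (Fin n))) (∅ : Set (Sym2 (Fin n))) := by
  funext e
  induction e using Sym2.ind with
  | _ p q =>
  by_cases hpq : p ∉ S₀ ∧ q ∉ S₀
  · -- the pair avoids `S₀`
    have heF : s(p, q) ∉ (↑F : Set (Sym2 (Fin n))) := fun h => by
      obtain ⟨hoe, -⟩ := (hF _).1 (Finset.mem_coe.1 h)
      rcases Sym2.mem_iff.1 hoe with rfl | rfl
      exacts [hpq.1 ho, hpq.2 ho]
    have heT : s(p, q) ∉ edgesTouching (↑S₀ : Set (Fin n)) := by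
      rintro ⟨v, hv, hvS⟩
      rcases Sym2.mem_iff.1 hv with rfl | rfl
      exacts [hpq.1 (Finset.mem_coe.1 hvS), hpq.2 (Finset.mem_coe.1 hvS)]
    rw [pinW_apply_of_not_mem w' ∅ heF, pinW_apply_of_not_mem w ∅ heT]
    have hfil : Finset.univ.filter (fun e => π e = some s(p, q)) = {s(p, q)} := by
      ext e
      simp only [Finset.mem_filter, Finset.mem_univ, true_and, Finset.mem_singleton]
      refine ⟨fun he => ?_, fun he => by rw [he]; exact hπ1 p q hpq.1 hpq.2⟩
      revert he
      induction e using Sym2.ind with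
      | _ x y =>
      intro he
      rcases hπ3 x y _ he with ⟨-, -, hk⟩ | ⟨-, -, hk⟩ | ⟨-, -, hk⟩
      · exact hk.symm
      · exfalso
        have hmem : o ∈ s(p, q) := by rw [hk]; exact Sym2.mem_mk_left o y
        rcases Sym2.mem_iff.1 hmem with rfl | rfl
        exacts [hpq.1 ho, hpq.2 ho]
      · exfalso
        have hmem : o ∈ s(p, q) := by rw [hk]; exact Sym2.mem_mk_left o x
        rcases Sym2.mem_iff.1 hmem with rfl | rfl
        exacts [hpq.1 ho, hpq.2 ho]
    apply Subtype.ext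
    rw [hw', hfil, Finset.prod_singleton]
    ring
  · -- the pair touches `S₀`
    have heT : s(p, q) ∈ edgesTouching (↑S₀ : Set (Fin n)) := by
      rw [not_and_or, not_not, not_not] at hpq
      rcases hpq with hp | hq
      exacts [⟨p, Sym2.mem_mk_left p q, Finset.mem_coe.2 hp⟩,
        ⟨q, Sym2.mem_mk_right p q, Finset.mem_coe.2 hq⟩]
    rw [pinW_apply_of_mem_of_not_mem w heT (Set.notMem_empty _)]
    by_cases heF : s(p, q) ∈ (↑F : Set (Sym2 (Fin n)))
    · exact pinW_apply_of_mem_of_not_mem w' heF (Set.notMem_empty _)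
    · rw [pinW_apply_of_not_mem w' ∅ heF]
      have hemp : ∀ e, π e ≠ some s(p, q) := by
        intro e
        induction e using Sym2.ind with
        | _ x y =>
        intro he
        rcases hπ3 x y _ he with ⟨hx, hy, hk⟩ | ⟨-, hy, hk⟩ | ⟨-, hx, hk⟩
        · apply hpq
          rcases Sym2.eq_iff.1 hk with ⟨rfl, rfl⟩ | ⟨rfl, rfl⟩
          exacts [⟨hx, hy⟩, ⟨hy, hx⟩]
        · apply heF
          rw [Finset.mem_coe, hF, hk]
          exact ⟨Sym2.mem_mk_left o y, fun hd => hoA (by rw [Sym2.mk_isDiag_iff.1 hd]; exact hy)⟩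
        · apply heF
          rw [Finset.mem_coe, hF, hk]
          exact ⟨Sym2.mem_mk_left o x, fun hd => hoA (by rw [Sym2.mk_isDiag_iff.1 hd]; exact hx)⟩
      have h := hw' s(p, q)
      rw [Finset.filter_eq_empty_iff.2 (fun e _ => hemp e), Finset.prod_empty, sub_self] at h
      exact Set.Icc.coe_eq_zero.1 h

/-- **A positive merged weight at `s(o, v)` comes from a positive-weight pair from `S₀` to `v`**
(the fibre of `s(o, v)` consists of the pairs `s(x, v)`, `x ∈ S₀`). -/
private theorem exists_weight_ne_zero_of_merge
    (hπ3 : ∀ x y k, π s(x, y) = some k → (x ∉ S₀ ∧ y ∉ S₀ ∧ k = s(x, y)) ∨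
      (x ∈ S₀ ∧ y ∈ A ∧ k = s(o, y)) ∨ (y ∈ S₀ ∧ x ∈ A ∧ k = s(o, x)))
    (hw' : ∀ k, (w' k : ℝ) = 1 - ∏ e ∈ Finset.univ.filter (fun e => π e = some k), (1 - (w e : ℝ)))
    (ho : o ∈ S₀) {v : Fin n} (hne : w' s(o, v) ≠ 0) : ∃ x ∈ S₀, w s(x, v) ≠ 0 := by
  by_contra hall
  push Not at hall
  apply hne
  have hprod : ∏ e ∈ Finset.univ.filter (fun e => π e = some s(o, v)), (1 - (w e : ℝ)) = 1 := by
    refine Finset.prod_eq_one fun e he => ?_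
    simp only [Finset.mem_filter, Finset.mem_univ, true_and] at he
    suffices h0 : w e = 0 by rw [h0]; simp
    revert he
    induction e using Sym2.ind with
    | _ x y =>
    intro he
    rcases hπ3 x y _ he with ⟨hx, hy, hk⟩ | ⟨hx, -, hk⟩ | ⟨hy, -, hk⟩
    · exfalso
      have hmem : o ∈ s(x, y) := by rw [← hk]; exact Sym2.mem_mk_left o v
      rcases Sym2.mem_iff.1 hmem with rfl | rfl
      exacts [hx ho, hy ho]
    · have hyv : y = v := by
        rcases Sym2.eq_iff.1 hk with ⟨-, h⟩ | ⟨h1, h2⟩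
        exacts [h.symm, h1.symm.trans h2.symm]
      rw [hyv]
      exact hall x hx
    · have hxv : x = v := by
        rcases Sym2.eq_iff.1 hk with ⟨-, h⟩ | ⟨h1, h2⟩
        exacts [h.symm, h1.symm.trans h2.symm]
      rw [hxv, Sym2.eq_swap]
      exact hall y hy
  have h := hw' s(o, v)
  rw [hprod, sub_self] at h
  exact Set.Icc.coe_eq_zero.1 h

/-- **Walk lemma (lifting back from the merged world).** If `S₀` is internally `o`-spanned, the
boundary pairs of the pocket are closed, and the merged configuration lies in
`{o ↔ A} ∩ {a ↮ b}` (`a, b ∉ S₀`), then the pocket of `ω` is exactly `S₀` (a path inside `Aᶜ`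
from `o` cannot cross the closed boundary), `o ↔ A` in `ω` (the first merged pair `{o, a'}` of an
open path comes from an open `{x, a'}`, `x ∈ S₀`), and `a ↮ b` in `ω` (`merge_mem_openConn`). -/
private theorem mem_pocket_inter_of_merge
    (hΦ' : ∀ ω u v, s(u, v) ∈ Φ ω ↔ (u ∉ S₀ ∧ v ∉ S₀ ∧ s(u, v) ∈ ω) ∨
      (u = o ∧ v ∈ A ∧ ∃ x ∈ S₀, s(x, v) ∈ ω) ∨ (v = o ∧ u ∈ A ∧ ∃ x ∈ S₀, s(x, u) ∈ ω))
    (hF₀ : ∀ x y, s(x, y) ∈ F₀ ↔ (x ∈ S₀ ∧ y ∉ S₀ ∧ y ∉ A) ∨ (y ∈ S₀ ∧ x ∉ S₀ ∧ x ∉ A))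
    (ho : o ∈ S₀) (hSA : Disjoint S₀ A) {a b : Fin n} (ha : a ∉ S₀) (hb : b ∉ S₀)
    {ω : Set (Sym2 (Fin n))} (hspan : ∀ v ∈ S₀, ω ∈ openConnIn (↑S₀ : Set (Fin n)) o v)
    (hcl : ∀ e ∈ F₀, e ∉ ω)
    (hΦω : Φ ω ∈ (⋃ a' ∈ A, openConn o a') ∩ (openConn a b)ᶜ) :
    ω ∈ {ω : Set (Sym2 (Fin n)) | ∀ v : Fin n, ω ∈ openConnIn (↑A : Set (Fin n))ᶜ o v ↔ v ∈ S₀} ∩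
      ((⋃ a' ∈ A, openConn o a') ∩ (openConn a b)ᶜ) := by
  obtain ⟨hU, hab⟩ := hΦω
  have hSU : (↑S₀ : Set (Fin n)) ⊆ (↑A : Set (Fin n))ᶜ := fun v hv hvA =>
    Finset.disjoint_left.1 hSA (Finset.mem_coe.1 hv) (Finset.mem_coe.1 hvA)
  refine ⟨fun v => ⟨fun hv => ?_, fun hv => ?_⟩, ?_,
    fun h => hab (merge_mem_openConn hΦ' hF₀ ho ha hb h hcl)⟩
  · -- a path inside `Aᶜ` from `o` cannot leave `S₀`
    have hp := DCT16.pathIn_of_mem_openConnIn hv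
    rcases hp.exit_or (R := (↑S₀ : Set (Fin n))) (Finset.mem_coe.2 ho) with
      h | ⟨x, y, hx, hy, hyU, hxy, -⟩
    · exact Finset.mem_coe.1 h.right_mem.1
    · exfalso
      rw [openGraph_adj] at hxy
      exact hcl _ ((hF₀ x y).2 (Or.inl ⟨Finset.mem_coe.1 hx, fun h => hy (Finset.mem_coe.2 h),
        fun h => hyU (Finset.mem_coe.2 h)⟩)) hxy.1
  · exact DCT16.mem_openConnIn_of_pathIn ((DCT16.pathIn_of_mem_openConnIn (hspan v hv)).mono hSU)
  · simp only [mem_iUnion, exists_prop] at hU ⊢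
    obtain ⟨a', ha'A, hoa'⟩ := hU
    have ha'o : a' ≠ o := fun h => (Finset.disjoint_left.1 hSA ho) (h ▸ ha'A)
    obtain ⟨p⟩ := hoa'
    cases p with
    | nil => exact absurd rfl ha'o
    | cons hadj _ =>
      obtain ⟨hmem, hne⟩ := (openGraph_adj (Φ ω) _ _).1 hadj
      rcases (hΦ' ω o _).1 hmem with ⟨hoS, -, -⟩ | ⟨-, hzA, x, hx, hxz⟩ | ⟨hzo, -, -⟩
      · exact absurd ho hoS
      · refine ⟨_, hzA, ?_⟩
        refine (openConnIn_subset_openConn _ o x (hspan x hx)).trans (SimpleGraph.Adj.reachable ?_)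
        rw [openGraph_adj]
        exact ⟨hxz, fun h => Finset.disjoint_left.1 hSA hx (h ▸ hzA)⟩
      · exact absurd hzo.symm hne

/-- **The per-pocket selection bound.** For a pocket value `S₀ ∋ o` disjoint from `A ∋ b`, a
comparison point `a ∉ S₀` admissible with respect to the weights with all pairs touching `S₀`
closed, and the merge data `π, Φ, w', F₀` of `S₀`:
`μ({o ↔ A, o ↮ b} ∩ {pocket = S₀}) ≤ μ({pocket = S₀} ∩ {o ↔ A, a ↮ b})`. -/
private theorem pocket_sel_term_le (w : Sym2 (Fin n) → unitInterval) {S₀ A : Finset (Fin n)}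
    {o b a : Fin n} (ho : o ∈ S₀) (hSA : Disjoint S₀ A) (hoA : o ∉ A) (hb : b ∈ A) (haS : a ∉ S₀)
    (hadm : ∀ v ∈ A, (∃ x ∈ S₀, w s(x, v) ≠ 0) →
      (prodBernoulli (pinW w (edgesTouching (↑S₀ : Set (Fin n))) (∅ : Set (Sym2 (Fin n))))).real
          (openConn a b) ≤
        (prodBernoulli (pinW w (edgesTouching (↑S₀ : Set (Fin n))) (∅ : Set (Sym2 (Fin n))))).real
          (openConn v b))
    {π : Sym2 (Fin n) → Option (Sym2 (Fin n))} {Φ : Set (Sym2 (Fin n)) → Set (Sym2 (Fin n))}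
    {w' : Sym2 (Fin n) → unitInterval} {F₀ : Finset (Sym2 (Fin n))}
    (hπ1 : ∀ x y, x ∉ S₀ → y ∉ S₀ → π s(x, y) = some s(x, y))
    (hπ2 : ∀ x y, x ∈ S₀ → y ∈ A → π s(x, y) = some s(o, y))
    (hπ3 : ∀ x y k, π s(x, y) = some k → (x ∉ S₀ ∧ y ∉ S₀ ∧ k = s(x, y)) ∨
      (x ∈ S₀ ∧ y ∈ A ∧ k = s(o, y)) ∨ (y ∈ S₀ ∧ x ∈ A ∧ k = s(o, x)))
    (hΦ : ∀ ω k, k ∈ Φ ω ↔ ∃ e ∈ ω, π e = some k)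
    (hw' : ∀ k, (w' k : ℝ) = 1 - ∏ e ∈ Finset.univ.filter (fun e => π e = some k), (1 - (w e : ℝ)))
    (hF₀ : ∀ x y, s(x, y) ∈ F₀ ↔ (x ∈ S₀ ∧ y ∉ S₀ ∧ y ∉ A) ∨ (y ∈ S₀ ∧ x ∉ S₀ ∧ x ∉ A)) :
    (prodBernoulli w).real (((⋃ a' ∈ A, openConn o a') ∩ (openConn o b)ᶜ) ∩
        {ω | ∀ v : Fin n, ω ∈ openConnIn (↑A : Set (Fin n))ᶜ o v ↔ v ∈ S₀}) ≤
      (prodBernoulli w).real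
        ({ω | ∀ v : Fin n, ω ∈ openConnIn (↑A : Set (Fin n))ᶜ o v ↔ v ∈ S₀} ∩
          ((⋃ a' ∈ A, openConn o a') ∩ (openConn a b)ᶜ)) := by
  set μ := prodBernoulli w with hμ
  set Span : Set (Set (Sym2 (Fin n))) := {ω | ∀ v ∈ S₀, ω ∈ openConnIn (↑S₀ : Set (Fin n)) o v}
    with hSpan
  set Cl : Set (Set (Sym2 (Fin n))) := {ω | ∀ e ∈ F₀, e ∉ ω} with hCl
  set Bad : Set (Set (Sym2 (Fin n))) := (⋃ a' ∈ A, openConn o a') ∩ (openConn o b)ᶜ with hBad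
  set Good : Set (Set (Sym2 (Fin n))) := (⋃ a' ∈ A, openConn o a') ∩ (openConn a b)ᶜ with hGood
  set Pock : Set (Set (Sym2 (Fin n))) :=
    {ω | ∀ v : Fin n, ω ∈ openConnIn (↑A : Set (Fin n))ᶜ o v ↔ v ∈ S₀} with hPock
  have hbS : b ∉ S₀ := fun h => Finset.disjoint_left.1 hSA h hb
  have hΦ' := mk_mem_merge_iff hπ1 hπ2 hπ3 hΦ
  have hkey : ∀ Y, μ.real (Φ ⁻¹' Y) = (prodBernoulli w').real Y :=
    prodBernoulli_real_preimage_fiberMap w w' π Φ hΦ hw'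
  have hdetΦ : ∀ Y, DeterminedBy (Φ ⁻¹' Y) (↑(S₀.sym2 ∪ F₀)ᶜ : Set (Sym2 (Fin n))) :=
    determinedBy_preimage_merge hπ3 hΦ hF₀ hSA
  -- pair-set bookkeeping (adapted from `pocket_term_le`)
  have hF₀S : (↑F₀ : Set (Sym2 (Fin n))) ⊆ (↑S₀.sym2 : Set (Sym2 (Fin n)))ᶜ := by
    intro e he heS
    rw [Finset.mem_coe] at he heS
    revert he heS
    induction e using Sym2.ind with
    | _ x y =>
    intro he heS
    rw [Finset.mk_mem_sym2_iff] at heS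
    rcases (hF₀ x y).1 he with ⟨-, hy, -⟩ | ⟨-, hx, -⟩
    exacts [hy heS.2, hx heS.1]
  have hES : (↑(S₀.sym2 ∪ F₀)ᶜ : Set (Sym2 (Fin n))) ⊆ (↑S₀.sym2 : Set (Sym2 (Fin n)))ᶜ := by
    intro e he heS
    rw [Finset.coe_compl, mem_compl_iff, Finset.coe_union, mem_union] at he
    exact he (Or.inl heS)
  have hEF : (↑(S₀.sym2 ∪ F₀)ᶜ : Set (Sym2 (Fin n))) ⊆ (↑F₀ : Set (Sym2 (Fin n)))ᶜ := by
    intro e he heF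
    rw [Finset.coe_compl, mem_compl_iff, Finset.coe_union, mem_union] at he
    exact he (Or.inr heF)
  -- independence of the three factors
  have hI : ∀ Y, μ.real (Span ∩ (Cl ∩ Φ ⁻¹' Y)) =
      μ.real Span * (μ.real Cl * (prodBernoulli w').real Y) := by
    intro Y
    rw [prodBernoulli_real_inter_of_determinedBy w S₀.sym2 (determinedBy_span S₀ o)
      (((determinedBy_forall_notMem F₀).mono hF₀S).inter ((hdetΦ Y).mono hES))
      MeasurableSet.of_discrete MeasurableSet.of_discrete,
      prodBernoulli_real_inter_of_determinedBy w F₀ (determinedBy_forall_notMem F₀)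
      ((hdetΦ Y).mono hEF) MeasurableSet.of_discrete MeasurableSet.of_discrete, hkey]
  -- the merged world: `o` is isolated off `A`, and `a` is admissible there
  have hiso : ∀ x : Fin n, x ∉ A → x ≠ o → w' s(o, x) = 0 := by
    intro x hxA hxo
    have h := hw' s(o, x)
    rw [Finset.filter_eq_empty_iff.2 (fun e _ => merge_ne_some hπ3 ho hxA hxo e),
      Finset.prod_empty, sub_self] at h
    exact Set.Icc.coe_eq_zero.1 h
  have hadm' : ∀ F : Finset (Sym2 (Fin n)), (∀ e, e ∈ F ↔ o ∈ e ∧ ¬ e.IsDiag) →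
      ∀ v ∈ A, w' s(o, v) ≠ 0 →
        (prodBernoulli (pinW w' (↑F : Set (Sym2 (Fin n))) (∅ : Set (Sym2 (Fin n))))).real
            (openConn a b) ≤
          (prodBernoulli (pinW w' (↑F : Set (Sym2 (Fin n))) (∅ : Set (Sym2 (Fin n))))).real
            (openConn v b) := by
    intro F hF v hv hne
    rw [pinW_star_merge_eq hF hπ1 hπ3 hw' ho hoA]
    exact hadm v hv (exists_weight_ne_zero_of_merge hπ3 hw' ho hne)
  have heart : (prodBernoulli w').real Bad ≤ (prodBernoulli w').real Good :=
    depthOneGluing_admissible n w' A o b a hoA hiso (hadm' _ fun e => by simp)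
  -- assemble
  have hsub1 : Bad ∩ Pock ⊆ Span ∩ (Cl ∩ Φ ⁻¹' Bad) := fun ω ⟨hbad, hω⟩ =>
    ⟨fun v hv => mem_openConnIn_of_pocket hω hv, fun e he => notMem_of_pocket hF₀ hω he,
      merge_mem_bad hΦ' hF₀ ho hSA hbad hω⟩
  have hsub2 : Span ∩ (Cl ∩ Φ ⁻¹' Good) ⊆ Pock ∩ Good := fun ω ⟨hsp, hcl, hΦω⟩ =>
    mem_pocket_inter_of_merge hΦ' hF₀ ho hSA haS hbS hsp hcl hΦω
  calc μ.real (Bad ∩ Pock) ≤ μ.real (Span ∩ (Cl ∩ Φ ⁻¹' Bad)) := measureReal_mono hsub1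
    _ = μ.real Span * (μ.real Cl * (prodBernoulli w').real Bad) := hI Bad
    _ ≤ μ.real Span * (μ.real Cl * (prodBernoulli w').real Good) :=
        mul_le_mul_of_nonneg_left (mul_le_mul_of_nonneg_left heart measureReal_nonneg)
          measureReal_nonneg
    _ = μ.real (Span ∩ (Cl ∩ Φ ⁻¹' Good)) := (hI Good).symm
    _ ≤ μ.real (Pock ∩ Good) := measureReal_mono hsub2

end PocketSelection

/-- **The pocket selection bound** (binder form): for an admissible selection rule `sel`,
`μ(o ↔ A, o ↮ b) ≤ Σ_{S₀ ∋ o, S₀ ∩ A = ∅} μ(pocket = S₀, o ↔ A, sel S₀ ↮ b)`.  Partition by the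
pocket; pockets containing their selected point are trivial, the others are `pocket_sel_term_le`
(Kozma–Nitzan arXiv:2401.12397 Thm 4 / Lemma 5 in the pocket-contracted world). -/
theorem pocketSelectionBound' (n : ℕ) (w : Sym2 (Fin n) → unitInterval) (A : Finset (Fin n))
    (o b : Fin n) (sel : Finset (Fin n) → Fin n) (hoA : o ∉ A) (hb : b ∈ A)
    (hadm : ∀ S₀ : Finset (Fin n), o ∈ S₀ → Disjoint S₀ A → ∀ v ∈ A, (∃ x ∈ S₀, w s(x, v) ≠ 0) →
      (prodBernoulli (pinW w (edgesTouching (↑S₀ : Set (Fin n))) (∅ : Set (Sym2 (Fin n))))).real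
          (openConn (sel S₀) b) ≤
        (prodBernoulli (pinW w (edgesTouching (↑S₀ : Set (Fin n))) (∅ : Set (Sym2 (Fin n))))).real
          (openConn v b)) :
    (prodBernoulli w).real ((⋃ a ∈ A, openConn o a) ∩ (openConn o b)ᶜ) ≤
      ∑ S₀ ∈ (Finset.univ : Finset (Finset (Fin n))).filter (fun S₀ => o ∈ S₀ ∧ Disjoint S₀ A),
        (prodBernoulli w).real
          ({ω | ∀ v : Fin n, ω ∈ openConnIn (↑A : Set (Fin n))ᶜ o v ↔ v ∈ S₀} ∩
            ((⋃ a ∈ A, openConn o a) ∩ (openConn (sel S₀) b)ᶜ)) := by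
  set Bad : Set (Set (Sym2 (Fin n))) := (⋃ a ∈ A, openConn o a) ∩ (openConn o b)ᶜ with hBad
  have hoU : o ∈ (↑A : Set (Fin n))ᶜ := fun h => hoA (Finset.mem_coe.1 h)
  -- partition according to the value of the pocket (adapted from `pocketBound`)
  have hcover : Bad ⊆ ⋃ S₀ ∈ (Finset.univ : Finset (Finset (Fin n))).filter
      (fun S₀ => o ∈ S₀ ∧ Disjoint S₀ A),
      (Bad ∩ {ω | ∀ v : Fin n, ω ∈ openConnIn (↑A : Set (Fin n))ᶜ o v ↔ v ∈ S₀}) := by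
    intro ω hω
    simp only [mem_iUnion, exists_prop, Finset.mem_filter, Finset.mem_univ, true_and]
    refine ⟨Finset.univ.filter (fun v => ω ∈ openConnIn (↑A : Set (Fin n))ᶜ o v), ⟨?_, ?_⟩,
      hω, fun v => by simp⟩
    · simp only [Finset.mem_filter, Finset.mem_univ, true_and]
      exact ⟨hoU, hoU, SimpleGraph.Reachable.refl _⟩
    · refine Finset.disjoint_left.2 fun v hv hvA => ?_
      simp only [Finset.mem_filter, Finset.mem_univ, true_and] at hv
      obtain ⟨-, hvU, -⟩ := hv
      exact hvU (Finset.mem_coe.2 hvA)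
  refine le_trans (measureReal_mono hcover (measure_ne_top _ _))
    (le_trans (measureReal_biUnion_finset_le _ _) ?_)
  refine Finset.sum_le_sum fun S₀ hS₀ => ?_
  simp only [Finset.mem_filter, Finset.mem_univ, true_and] at hS₀
  obtain ⟨hoS, hSA⟩ := hS₀
  by_cases hsel : sel S₀ ∈ S₀
  · -- the selected point lies in the pocket: `sel S₀ ↔ b` would force `o ↔ b`
    refine measureReal_mono ?_
    rintro ω ⟨⟨hU, hnb⟩, hω⟩
    refine ⟨hω, hU, fun hsb => hnb ?_⟩
    exact (openConnIn_subset_openConn _ o _ (mem_openConnIn_of_pocket hω hsel)).trans hsb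
  · obtain ⟨π, hπ1, hπ2, hπ3⟩ := exists_mergeFiber S₀ A o hSA
    obtain ⟨w', hw'⟩ := exists_fiberWeights w π
    obtain ⟨F₀, hF₀⟩ := exists_boundaryPairs S₀ A
    exact pocket_sel_term_le w hoS hSA hoA hb hsel (hadm S₀ hoS hSA) hπ1 hπ2 hπ3
      (Φ := fun ω => {k | ∃ e ∈ ω, π e = some k}) (fun _ _ => Iff.rfl) hw' hF₀

/-- **Registered sub-goal `pocketSelectionBound` of crux stmt-CriticalPhenomena-4575** (verbatim
signature, fully qualified): THE POCKET SELECTION BOUND — for any admissible selection rule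
`sel` (for every pocket shape `S₀ ∋ o` disjoint from `A` and every relay point `v ∈ A` joined to
`S₀` by a positive-weight pair, `P_{G−S₀}(sel S₀ ↔ b) ≤ P_{G−S₀}(v ↔ b)`),
`μ(o ↔ A, o ↮ b) ≤ Σ_{S₀ ∋ o, S₀ ∩ A = ∅} μ(pocket = S₀, o ↔ A, sel S₀ ↮ b)`.
See `pocketSelectionBound'`. -/
theorem pocketSelectionBound :
    ∀ (n : ℕ) (w : Sym2 (Fin n) → unitInterval) (A : Finset (Fin n)) (o b : Fin n) (sel : Finset
    (Fin n) → Fin n), o ∉ A → b ∈ A → (∀ S₀ : Finset (Fin n), o ∈ S₀ → Disjoint S₀ A → ∀ v ∈ A, (∃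
    x ∈ S₀, w s(x, v) ≠ 0) → (Literature.Probability.LatticeModels.prodBernoulli
    (Literature.Probability.Percolation.pinW w (Literature.Probability.Percolation.edgesTouching
    (↑S₀ : Set (Fin n))) (∅ : Set (Sym2 (Fin n))))).real (Literature.Probability.Percolation.openConn
    (sel S₀) b) ≤ (Literature.Probability.LatticeModels.prodBernoulli
    (Literature.Probability.Percolation.pinW w (Literature.Probability.Percolation.edgesTouching
    (↑S₀ : Set (Fin n))) (∅ : Set (Sym2 (Fin n))))).real (Literature.Probability.Percolation.openConn
    v b)) → (Literature.Probability.LatticeModels.prodBernoulli w).real ((⋃ a ∈ A,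
    Literature.Probability.Percolation.openConn o a) ∩ (Literature.Probability.Percolation.openConn o
    b)ᶜ) ≤ ∑ S₀ ∈ (Finset.univ : Finset (Finset (Fin n))).filter (fun S₀ => o ∈ S₀ ∧ Disjoint S₀
    A), (Literature.Probability.LatticeModels.prodBernoulli w).real ({ω | ∀ v : Fin n, ω ∈
    Literature.Probability.Percolation.openConnIn (↑A : Set (Fin n))ᶜ o v ↔ v ∈ S₀} ∩ ((⋃ a ∈ A,
    Literature.Probability.Percolation.openConn o a) ∩ (Literature.Probability.Percolation.openConn
    (sel S₀) b)ᶜ)) :=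
  fun n w A o b sel ho hb hadm => pocketSelectionBound' n w A o b sel ho hb hadm

end Summit.CriticalPhenomena.PercolationContinuityZ3.Theorems
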